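import Literature.Computation.Certificates.SDPStrongDuality
import Literature.Analysis.Convex.MatrixStarAlgebraPSD
import HarnessLib

/-!
# Strong duality for BLOCK-DIAGONAL semidefinite programs (Jansson–Chaykin–Keil Thm 1.1, Thm 4.1 «Moreover»)

`SDPStrongDuality.lean` proves the Strong Duality Theorem for the standard SINGLE-block pair of
`SemidefiniteComplementarity` (`⟨A_i, X⟩ = b_i`, `X ⪰ 0` / `C − Σ y_i A_i ⪰ 0`). The rigorous-bounds
papers and every certificate format in this directory use the BLOCK-DIAGONAL standard form of
Jansson–Chaykin–Keil (1.1)/(1.3),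

  (P) `p* = min Σ_j ⟨C_j, X_j⟩  s.t.  Σ_j ⟨A_ij, X_j⟩ = b_i (i = 1..m),  X_j ⪰ 0 (j = 1..n)`,
  (D) `d* = max bᵀy  s.t.  C_j − Σ_i y_i A_ij ⪰ 0 (j = 1..n)`,

in exactly the layout of `JanssonChaykinKeil.theorem_3_2` / `theorem_4_1` (`SemidefiniteRigorousBounds`:
blocks `j : ι` of sizes `σ j`, data `C : ∀ j, Matrix (σ j) (σ j) ℝ`, `A : μ → ∀ j, Matrix (σ j) (σ j) ℝ`,
`⟨C, X⟩ = trace (C * X)`). This file transports the single-block theorems to that layout by the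
block-diagonal lifting `X ↦ Matrix.blockDiagonal' X` (a feasible point of (P) lifts to a feasible
point of the lifted one-block program with the same value; the diagonal blocks of a lifted-feasible
point are (P)-feasible with the same value; dual feasibility is literally the same condition), and
states, AS PRINTED [JCK, SIAM J. Numer. Anal. 46 (2007/08); authors' preprint p. 2, read]:

*"Theorem 1.1 (Strong Duality Theorem). a) If (1.1) is strictly feasible (i.e., there exist feasible
positive definite matrices X_j for j = 1,…,n) and p\* is finite, then p\* = d\* and the dual supremum
is attained. b) If (1.3) is strictly feasible (i.e., there exists some y ∈ ℝᵐ such that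
C_j − Σ_{i=1}^m y_i A_ij are positive definite for j = 1,…,n) and d\* is finite, then p\* = d\*, and
the primal infimum is attained."* — `theorem_1_1a`, `theorem_1_1b`;

and the «Moreover» clause of Thm 4.1 for point data [preprint p. 9 L37–L40, read]: *"Moreover, if all
symmetric X_j ∈ 𝐗_j are positive definite and p\*(P) is bounded from below, then p\*(P) = d\*(P) for
every P ∈ 𝐏 (no duality gap), and the dual supremum is attained"* — `theorem_4_1_strongDuality`
(its proof in the paper IS "apply Theorem 1.1 a)").

"p\* finite" is rendered as "a lower bound `p` of the primal values exists" (the primal is feasible by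
the strict-feasibility hypothesis, so p\* < +∞ automatically); "d\* finite" dually. Values are the
sets `{v | ∃ X feasible, v = Σ_j ⟨C_j, X_j⟩}` written exactly as in `JanssonChaykinKeil.theorem_4_1`.
[cite: JanssonChaykinKeil2008, Thm 1.1] [cite: JanssonChaykinKeil2008, Thm 4.1]

WHY HERE: a VSDP-style verdict "zero duality gap / optimal solutions exist" (Rump, Acta Numerica 2010
§14.2: *"VSDP … could verify the existence of strictly dual feasible solutions proving that all
problems have a zero duality gap"*) instantiates exactly these statements; the bound certificates
(`lmiForm_bound`, `theorem_3_2`, `theorem_4_1`, primal/1) do NOT need them.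
NOT HERE: interval families `𝐏` (apply pointwise); infeasibility/unboundedness alternatives.
HONEST FRAMING: statements only; no number.
-/

namespace Literature.Computation.Certificates

namespace JanssonChaykinKeil

open Matrix Finset
open SemidefiniteComplementarity (frob IsPrimalFeasible slack IsDualFeasible)

variable {ι : Type*} [Fintype ι] [DecidableEq ι] {σ : ι → Type*} [∀ j, Fintype (σ j)]
  [∀ j, DecidableEq (σ j)] {μ : Type*} [Fintype μ]

/-! ### §1 The block-diagonal lifting (plumbing) -/

omit [∀ j, DecidableEq (σ j)] [Fintype μ] in
/-- `⟨blockDiagonal' M, X⟩ = Σ_j ⟨M_j, X_jj⟩`: the trace pairing of a block-diagonal matrix with an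
arbitrary matrix only sees the diagonal blocks `X.blockDiag' j`. Private plumbing. [folklore] -/
private theorem trace_blockDiagonal'_mul (M : ∀ j, Matrix (σ j) (σ j) ℝ)
    (X : Matrix (Σ j, σ j) (Σ j, σ j) ℝ) :
    trace (blockDiagonal' M * X) = ∑ j, trace (M j * X.blockDiag' j) := by
  simp only [Matrix.trace, Matrix.diag_apply, Matrix.mul_apply]
  rw [← Finset.univ_sigma_univ, Finset.sum_sigma]
  refine Finset.sum_congr rfl fun j _ => Finset.sum_congr rfl fun a _ => ?_
  rw [Finset.sum_sigma, Finset.sum_eq_single j]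
  · simp [blockDiagonal'_apply_eq, blockDiag'_apply]
  · intro k _ hkj
    simp [blockDiagonal'_apply_ne M a _ (Ne.symm hkj)]
  · simp

omit [∀ j, DecidableEq (σ j)] [Fintype μ] in
/-- `⟨blockDiagonal' M, blockDiagonal' X⟩ = Σ_j ⟨M_j, X_j⟩`. Private plumbing. [folklore] -/
private theorem trace_blockDiagonal'_mul_blockDiagonal' (M X : ∀ j, Matrix (σ j) (σ j) ℝ) :
    trace (blockDiagonal' M * blockDiagonal' X) = ∑ j, trace (M j * X j) := by
  rw [trace_blockDiagonal'_mul]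
  simp [blockDiag'_blockDiagonal']

omit [Fintype ι] [∀ j, Fintype (σ j)] [∀ j, DecidableEq (σ j)] in
/-- The dual slack of the lifted program is the block-diagonal matrix of the block slacks.
Private plumbing. [folklore] -/
private theorem slack_blockDiagonal' (C : ∀ j, Matrix (σ j) (σ j) ℝ)
    (A : μ → ∀ j, Matrix (σ j) (σ j) ℝ) (y : μ → ℝ) :
    slack (blockDiagonal' C) (fun i => blockDiagonal' (A i)) y =
      blockDiagonal' (fun j => C j - ∑ i, y i • A i j) := by
  unfold SemidefiniteComplementarity.slack
  have hsum : (∑ i, y i • blockDiagonal' (A i)) =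
      blockDiagonal' (fun j => ∑ i, y i • A i j) := by
    have : (fun j => ∑ i, y i • A i j) = ∑ i, y i • A i := by
      funext j
      simp [Finset.sum_apply, Pi.smul_apply]
    rw [this, ← blockDiagonal'AddMonoidHom_apply, map_sum]
    refine Finset.sum_congr rfl fun i _ => ?_
    rw [blockDiagonal'AddMonoidHom_apply, blockDiagonal'_smul]
  rw [hsum, ← blockDiagonal'_sub]
  rfl

omit [Fintype ι] [DecidableEq ι] [∀ j, Fintype (σ j)] [∀ j, DecidableEq (σ j)] in
/-- A diagonal block of a positive semidefinite matrix is positive semidefinite. Private plumbing.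
[folklore] -/
private theorem posSemidef_blockDiag' {X : Matrix (Σ j, σ j) (Σ j, σ j) ℝ} (hX : X.PosSemidef)
    (j : ι) : (X.blockDiag' j).PosSemidef := by
  have e : X.submatrix (Sigma.mk j) (Sigma.mk j) = X.blockDiag' j := by
    ext a b
    simp [blockDiag'_apply]
  simpa [e] using hX.submatrix (Sigma.mk j)

omit [∀ j, DecidableEq (σ j)] in
/-- Quadratic form of a block-diagonal matrix, coordinatewise. Private plumbing. [folklore] -/
private theorem blockDiagonal'_mulVec_apply (M : ∀ j, Matrix (σ j) (σ j) ℝ) (x : (Σ j, σ j) → ℝ)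
    (j : ι) (a : σ j) :
    (blockDiagonal' M *ᵥ x) ⟨j, a⟩ = (M j *ᵥ fun b => x ⟨j, b⟩) a := by
  simp only [mulVec, dotProduct]
  rw [← Finset.univ_sigma_univ, Finset.sum_sigma, Finset.sum_eq_single j]
  · simp [blockDiagonal'_apply_eq]
  · intro k _ hkj
    simp [blockDiagonal'_apply_ne M a _ (Ne.symm hkj)]
  · simp

omit [∀ j, DecidableEq (σ j)] in
/-- A block-diagonal matrix of positive DEFINITE blocks is positive definite (strict feasibility
lifts). Private plumbing. [folklore] -/
private theorem posDef_blockDiagonal' {M : ∀ j, Matrix (σ j) (σ j) ℝ} (hM : ∀ j, (M j).PosDef) :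
    (blockDiagonal' M).PosDef := by
  refine PosDef.of_dotProduct_mulVec_pos ?_ fun x hx => ?_
  · rw [IsHermitian, blockDiagonal'_conjTranspose]
    congr 1
    funext j
    exact (hM j).1
  · have hsplit : star x ⬝ᵥ (blockDiagonal' M *ᵥ x) =
        ∑ j, star (fun b => x ⟨j, b⟩) ⬝ᵥ (M j *ᵥ fun b => x ⟨j, b⟩) := by
      simp only [dotProduct]
      rw [← Finset.univ_sigma_univ, Finset.sum_sigma]
      refine Finset.sum_congr rfl fun j _ => Finset.sum_congr rfl fun a _ => ?_
      rw [blockDiagonal'_mulVec_apply]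
      rfl
    rw [hsplit]
    obtain ⟨⟨j, a⟩, hja⟩ : ∃ p, x p ≠ 0 := by
      simpa using Function.ne_iff.1 hx
    have hxj : (fun b => x ⟨j, b⟩) ≠ 0 := fun h => hja (by simpa using congr_fun h a)
    refine lt_of_lt_of_le ((hM j).dotProduct_mulVec_pos hxj) ?_
    refine Finset.single_le_sum (f := fun k => star (fun b => x ⟨k, b⟩) ⬝ᵥ (M k *ᵥ fun b => x ⟨k, b⟩))
      (fun k _ => (hM k).posSemidef.dotProduct_mulVec_nonneg _) (Finset.mem_univ j)

omit [Fintype μ] in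
/-- A primal feasible point of the block program lifts to a feasible point of the one-block program,
value preserved. Private plumbing. [folklore] -/
private theorem lift_feasible (C : ∀ j, Matrix (σ j) (σ j) ℝ) (A : μ → ∀ j, Matrix (σ j) (σ j) ℝ)
    (b : μ → ℝ) {X : ∀ j, Matrix (σ j) (σ j) ℝ} (hX : ∀ j, (X j).PosSemidef)
    (hAX : ∀ i, ∑ j, trace (A i j * X j) = b i) :
    IsPrimalFeasible (fun i => blockDiagonal' (A i)) b (blockDiagonal' X) ∧
      frob (blockDiagonal' C) (blockDiagonal' X) = ∑ j, trace (C j * X j) := by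
  refine ⟨⟨(Literature.Analysis.Convex.MatrixStarAlgebra.posSemidef_blockDiagonal'_iff X).2 hX,
    fun i => ?_⟩, ?_⟩
  · simp only [SemidefiniteComplementarity.frob, trace_blockDiagonal'_mul_blockDiagonal', hAX i]
  · simp only [SemidefiniteComplementarity.frob, trace_blockDiagonal'_mul_blockDiagonal']

omit [Fintype μ] [∀ j, DecidableEq (σ j)] in
/-- The diagonal blocks of a feasible point of the one-block program are feasible for the block
program, value preserved. Private plumbing. [folklore] -/
private theorem blocks_feasible (C : ∀ j, Matrix (σ j) (σ j) ℝ) (A : μ → ∀ j, Matrix (σ j) (σ j) ℝ)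
    (b : μ → ℝ) {X : Matrix (Σ j, σ j) (Σ j, σ j) ℝ}
    (hX : IsPrimalFeasible (fun i => blockDiagonal' (A i)) b X) :
    (∀ j, (X.blockDiag' j).PosSemidef) ∧ (∀ i, ∑ j, trace (A i j * X.blockDiag' j) = b i) ∧
      frob (blockDiagonal' C) X = ∑ j, trace (C j * X.blockDiag' j) := by
  refine ⟨posSemidef_blockDiag' hX.1, fun i => ?_, ?_⟩
  · have := hX.2 i
    simpa [SemidefiniteComplementarity.frob, trace_blockDiagonal'_mul] using this
  · simp [SemidefiniteComplementarity.frob, trace_blockDiagonal'_mul]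

/-- Dual feasibility of the lifted program is dual feasibility of the block program. Private
plumbing. [folklore] -/
private theorem isDualFeasible_lift_iff (C : ∀ j, Matrix (σ j) (σ j) ℝ)
    (A : μ → ∀ j, Matrix (σ j) (σ j) ℝ) (y : μ → ℝ) :
    IsDualFeasible (blockDiagonal' C) (fun i => blockDiagonal' (A i)) y ↔
      ∀ j, (C j - ∑ i, y i • A i j).PosSemidef := by
  unfold SemidefiniteComplementarity.IsDualFeasible
  rw [slack_blockDiagonal']
  exact Literature.Analysis.Convex.MatrixStarAlgebra.posSemidef_blockDiagonal'_iff _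

omit [Fintype μ] in
/-- The primal value sets of the block program and of its lifting coincide. Private plumbing.
[folklore] -/
private theorem primal_values_eq (C : ∀ j, Matrix (σ j) (σ j) ℝ) (A : μ → ∀ j, Matrix (σ j) (σ j) ℝ)
    (b : μ → ℝ) :
    {v | ∃ X, IsPrimalFeasible (fun i => blockDiagonal' (A i)) b X ∧ frob (blockDiagonal' C) X = v} =
      {v : ℝ | ∃ X : ∀ j, Matrix (σ j) (σ j) ℝ, (∀ j, (X j).PosSemidef) ∧
        (∀ i, ∑ j, trace (A i j * X j) = b i) ∧ v = ∑ j, trace (C j * X j)} := by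
  ext v
  constructor
  · rintro ⟨X, hX, rfl⟩
    obtain ⟨h1, h2, h3⟩ := blocks_feasible C A b hX
    exact ⟨fun j => X.blockDiag' j, h1, h2, h3⟩
  · rintro ⟨X, hX, hAX, rfl⟩
    obtain ⟨h1, h2⟩ := lift_feasible C A b hX hAX
    exact ⟨blockDiagonal' X, h1, h2⟩

/-- The dual value sets of the block program and of its lifting coincide. Private plumbing.
[folklore] -/
private theorem dual_values_eq (C : ∀ j, Matrix (σ j) (σ j) ℝ) (A : μ → ∀ j, Matrix (σ j) (σ j) ℝ)
    (b : μ → ℝ) :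
    {v | ∃ y, IsDualFeasible (blockDiagonal' C) (fun i => blockDiagonal' (A i)) y ∧
        ∑ i, b i * y i = v} =
      {v : ℝ | ∃ y : μ → ℝ, (∀ j, (C j - ∑ i, y i • A i j).PosSemidef) ∧ v = ∑ i, b i * y i} := by
  ext v
  simp only [Set.mem_setOf_eq, isDualFeasible_lift_iff]
  constructor
  · rintro ⟨y, hy, rfl⟩
    exact ⟨y, hy, rfl⟩
  · rintro ⟨y, hy, rfl⟩
    exact ⟨y, hy, rfl⟩

omit [Fintype ι] [∀ j, Fintype (σ j)] [∀ j, DecidableEq (σ j)] [Fintype μ] in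
/-- Hermitian blocks lift to a Hermitian block-diagonal matrix. Private plumbing. [folklore] -/
private theorem isHermitian_blockDiagonal' {M : ∀ j, Matrix (σ j) (σ j) ℝ}
    (hM : ∀ j, (M j).IsHermitian) : (blockDiagonal' M).IsHermitian := by
  rw [IsHermitian, blockDiagonal'_conjTranspose]
  congr 1
  funext j
  exact (hM j).eq

/-! ### §2 Theorem 1.1 and the «Moreover» clause of Theorem 4.1, block form -/

/-- **Jansson–Chaykin–Keil Theorem 1.1 a) (Strong Duality, block-diagonal form).** *"If (1.1) is
strictly feasible (i.e., there exist feasible positive definite matrices X_j for j = 1,…,n) and p\* is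
finite, then p\* = d\* and the dual supremum is attained"*: given symmetric data, feasible `X₀` with
every block positive definite and a lower bound `p` of the primal objective on the feasible set,
there is a dual feasible `y` (`C_j − Σ_i y_i A_ij ⪰ 0` for all `j`) whose value `bᵀy` EQUALS the
primal infimum `p\*` and which maximises `bᵀy'` over all dual feasible `y'` (so `p\* = d\*`, attained).
Transported from `SDPStrongDuality.exists_dual_eq_sInf` (one block) by the block-diagonal lifting.
[cite: JanssonChaykinKeil2008, Thm 1.1] -/
theorem theorem_1_1a (C : ∀ j, Matrix (σ j) (σ j) ℝ) (A : μ → ∀ j, Matrix (σ j) (σ j) ℝ)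
    (b : μ → ℝ) (hA : ∀ i j, (A i j).IsHermitian) (hC : ∀ j, (C j).IsHermitian)
    {X₀ : ∀ j, Matrix (σ j) (σ j) ℝ} (hX₀ : ∀ j, (X₀ j).PosDef)
    (hX₀b : ∀ i, ∑ j, trace (A i j * X₀ j) = b i) {p : ℝ}
    (hp : ∀ X : ∀ j, Matrix (σ j) (σ j) ℝ, (∀ j, (X j).PosSemidef) →
      (∀ i, ∑ j, trace (A i j * X j) = b i) → p ≤ ∑ j, trace (C j * X j)) :
    ∃ y : μ → ℝ, (∀ j, (C j - ∑ i, y i • A i j).PosSemidef) ∧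
      ∑ i, b i * y i = sInf {v : ℝ | ∃ X : ∀ j, Matrix (σ j) (σ j) ℝ, (∀ j, (X j).PosSemidef) ∧
        (∀ i, ∑ j, trace (A i j * X j) = b i) ∧ v = ∑ j, trace (C j * X j)} ∧
      ∀ y' : μ → ℝ, (∀ j, (C j - ∑ i, y' i • A i j).PosSemidef) →
        ∑ i, b i * y' i ≤ ∑ i, b i * y i := by
  have hAbig : ∀ i, (blockDiagonal' (A i)).IsHermitian := fun i => isHermitian_blockDiagonal' (hA i)
  have hCbig : (blockDiagonal' C).IsHermitian := isHermitian_blockDiagonal' hC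
  have hX₀big : (blockDiagonal' X₀).PosDef := posDef_blockDiagonal' hX₀
  have hX₀b' : ∀ i, frob (blockDiagonal' (A i)) (blockDiagonal' X₀) = b i :=
    (lift_feasible C A b (fun j => (hX₀ j).posSemidef) hX₀b).1.2
  have hp' : ∀ X, IsPrimalFeasible (fun i => blockDiagonal' (A i)) b X →
      p ≤ frob (blockDiagonal' C) X := by
    intro X hX
    obtain ⟨h1, h2, h3⟩ := blocks_feasible C A b hX
    rw [h3]
    exact hp _ h1 h2
  obtain ⟨y, hy, hval, hopt⟩ :=
    SDPStrongDuality.exists_dual_eq_sInf (A := fun i => blockDiagonal' (A i)) (b := b)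
      (C := blockDiagonal' C) hAbig hCbig hX₀big hX₀b' hp'
  refine ⟨y, (isDualFeasible_lift_iff C A y).1 hy, ?_, fun y' hy' => hopt y'
    ((isDualFeasible_lift_iff C A y').2 hy')⟩
  rw [hval, primal_values_eq]

/-- **Jansson–Chaykin–Keil Theorem 1.1 b) (block-diagonal form).** *"If (1.3) is strictly feasible
(i.e., there exists some y ∈ ℝᵐ such that C_j − Σ_{i=1}^m y_i A_ij are positive definite for
j = 1,…,n) and d\* is finite, then p\* = d\*, and the primal infimum is attained"*: given symmetric
data, `y₀` with every block slack positive definite and an upper bound `d` of `bᵀy` on the dual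
feasible set, there is a primal feasible `X` whose value EQUALS the dual supremum `d\*` and which
minimises the primal objective (so `p\* = d\*`, attained). Transported from
`SDPStrongDuality.exists_primal_eq_sSup`. [cite: JanssonChaykinKeil2008, Thm 1.1] -/
theorem theorem_1_1b (C : ∀ j, Matrix (σ j) (σ j) ℝ) (A : μ → ∀ j, Matrix (σ j) (σ j) ℝ)
    (b : μ → ℝ) (hA : ∀ i j, (A i j).IsHermitian) (hC : ∀ j, (C j).IsHermitian)
    {y₀ : μ → ℝ} (hy₀ : ∀ j, (C j - ∑ i, y₀ i • A i j).PosDef) {d : ℝ}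
    (hd : ∀ y : μ → ℝ, (∀ j, (C j - ∑ i, y i • A i j).PosSemidef) → ∑ i, b i * y i ≤ d) :
    ∃ X : ∀ j, Matrix (σ j) (σ j) ℝ, (∀ j, (X j).PosSemidef) ∧
      (∀ i, ∑ j, trace (A i j * X j) = b i) ∧
      ∑ j, trace (C j * X j) = sSup {v : ℝ | ∃ y : μ → ℝ,
        (∀ j, (C j - ∑ i, y i • A i j).PosSemidef) ∧ v = ∑ i, b i * y i} ∧
      ∀ X' : ∀ j, Matrix (σ j) (σ j) ℝ, (∀ j, (X' j).PosSemidef) →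
        (∀ i, ∑ j, trace (A i j * X' j) = b i) → ∑ j, trace (C j * X j) ≤ ∑ j, trace (C j * X' j) := by
  have hAbig : ∀ i, (blockDiagonal' (A i)).IsHermitian := fun i => isHermitian_blockDiagonal' (hA i)
  have hCbig : (blockDiagonal' C).IsHermitian := isHermitian_blockDiagonal' hC
  have hy₀big : (slack (blockDiagonal' C) (fun i => blockDiagonal' (A i)) y₀).PosDef := by
    rw [slack_blockDiagonal']
    exact posDef_blockDiagonal' hy₀
  have hd' : ∀ y, IsDualFeasible (blockDiagonal' C) (fun i => blockDiagonal' (A i)) y →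
      ∑ i, b i * y i ≤ d := fun y hy => hd y ((isDualFeasible_lift_iff C A y).1 hy)
  obtain ⟨X, hX, hval, hopt⟩ :=
    SDPStrongDuality.exists_primal_eq_sSup (A := fun i => blockDiagonal' (A i)) (b := b)
      (C := blockDiagonal' C) hAbig hCbig hy₀big hd'
  obtain ⟨h1, h2, h3⟩ := blocks_feasible C A b hX
  refine ⟨fun j => X.blockDiag' j, h1, h2, ?_, fun X' hX' hAX' => ?_⟩
  · rw [← h3, hval, dual_values_eq]
  · obtain ⟨hX'big, hval'⟩ := lift_feasible C A b hX' hAX'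
    rw [← h3, ← hval']
    exact hopt _ hX'big

/-- **The «Moreover» clause of Jansson–Chaykin–Keil Theorem 4.1 (point data).** *"Moreover, if all
symmetric X_j ∈ 𝐗_j are positive definite and p\*(P) is bounded from below, then p\*(P) = d\*(P) …
(no duality gap), and the dual supremum is attained"* — for a single problem `P`: a feasible point
`X̂` with positive definite blocks (the upper-bound witness of `theorem_4_1`) plus boundedness below of
the primal value set give a dual feasible `y` attaining `bᵀy = p\*` and maximal among dual feasible
points. As in the paper, this IS Theorem 1.1 a) (`theorem_1_1a`). [cite: JanssonChaykinKeil2008, Thm 4.1] -/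
theorem theorem_4_1_strongDuality (C : ∀ j, Matrix (σ j) (σ j) ℝ)
    (A : μ → ∀ j, Matrix (σ j) (σ j) ℝ) (b : μ → ℝ) (hA : ∀ i j, (A i j).IsHermitian)
    (hC : ∀ j, (C j).IsHermitian) {Xh : ∀ j, Matrix (σ j) (σ j) ℝ} (hXh : ∀ j, (Xh j).PosDef)
    (hAXh : ∀ i, ∑ j, trace (A i j * Xh j) = b i)
    (hbdd : BddBelow {v : ℝ | ∃ X : ∀ j, Matrix (σ j) (σ j) ℝ, (∀ j, (X j).PosSemidef) ∧
      (∀ i, ∑ j, trace (A i j * X j) = b i) ∧ v = ∑ j, trace (C j * X j)}) :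
    ∃ y : μ → ℝ, (∀ j, (C j - ∑ i, y i • A i j).PosSemidef) ∧
      ∑ i, b i * y i = sInf {v : ℝ | ∃ X : ∀ j, Matrix (σ j) (σ j) ℝ, (∀ j, (X j).PosSemidef) ∧
        (∀ i, ∑ j, trace (A i j * X j) = b i) ∧ v = ∑ j, trace (C j * X j)} ∧
      ∀ y' : μ → ℝ, (∀ j, (C j - ∑ i, y' i • A i j).PosSemidef) →
        ∑ i, b i * y' i ≤ ∑ i, b i * y i := by
  obtain ⟨p, hp⟩ := hbdd
  exact theorem_1_1a C A b hA hC hXh hAXh (p := p)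
    fun X hX hAX => hp ⟨X, hX, hAX, rfl⟩

end JanssonChaykinKeil

end Literature.Computation.Certificates
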